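import Literature.AnabelianGeometry.SemiGraphs.TemperedPiChartExists
import HarnessLib

/-!
# The tempered fundamental group chart of an ARBITRARY Galois tower ([SemiAnbd] Prop 3.6 (i)(ii) p. 38)

Mochizuki, *Semi-graphs of anabelioids*, Publ. RIMS **42** (2006), §3 p. 38: "Let `{G_i → G}_{i ∈ I}` be
some cofinal collection of connected finite étale Galois coverings … `π₁^temp(G) := lim Gal(G_{∞,i}/G)`.
Note that `π₁^temp(G)` is independent, up to inner automorphism, of the choice of the cofinal system.
Proposition 3.6 … (i) The topological group `π₁^temp(G)` defined above is tempered. (ii) There is a natural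
equivalence of categories `B^temp(π₁^temp(G)) ⥲ B^temp(G)`" [cite: MochizukiSemiAnbd2006, Prop 3.6(i)(ii) p.38].

Seat abc-iut-L3-t9 (the Galois-tower lineage), cell row T54-B (`plan/GAP-LEDGER.md` G-w4d053-1), E1
junction (J2a).  `TemperedPiFunctor.lean` / `TemperedPiChartExists.lean` build the fibre functor and the
chart `𝒢.temperedPiChart h36` ONLY for the fixed enumeration `𝒢.galoisLevelData h36`; the underlying fibre
machinery (`fibreObj`, `fibreMap`, `fullHom`, `realize`, `realizeIso`) is generic in the tower.  This file
packages Prop 3.6 (i)(ii) for ANY Galois level data `D` of a connected `𝒢` whose levels are COFINAL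
(`hcof`: every component of every tempered covering is split by the levels from some level on — for a
prescribed tower `GaloisLevelData.ofGaloisSeq` this is `ofGaloisSeq_exists_level_splits_component(_of_dominates)`,
`GaloisLevelDataOfSeq.lean`), split themselves, are finite and have nonempty fibres:

* `GaloisLevelData.levelOf` / `levelOf_spec` — a splitting level for each point over the base vertex;
* `GaloisLevelData.fibreFunctor` — `T ↦ T_{v₀}` with its `π₁^temp`-action, `B^temp(𝒢) ⥤ B^temp(π₁^temp)`;
  faithful (`𝔾` connected), full (`fullHom`), essentially surjective (`realize`): an equivalence;
* `GaloisLevelData.chartEquiv`, **`GaloisLevelData.chart`** — `B^temp(𝒢) ≌ B^temp(lim Gal(𝒢_{∞,n}/𝒢))` and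
  the resulting `TemperedPiChart` with `(D.chart …).G = D.temperedPi h𝒢` (`chart_G`, definitional).

With it, a tower with CHARACTERISTIC finite levels (E1a/E1b) carries its own chart, over which the T54-B
capstone's stability binders are theorems (`ArithTowerLevelStabilityJunction.lean`).  Nothing here takes a
side on [IUTchIII] Cor. 3.12; typed ≠ proved.
-/

namespace Literature.AnabelianGeometry.SemiGraphs

namespace ProfiniteSemiGraph

open CategoryTheory Topology

universe u

namespace GaloisLevelData

variable {𝒢 : ProfiniteSemiGraph.{u}} (D : GaloisLevelData 𝒢) (h𝒢 : 𝒢.IsCountable)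
  (hcof : ∀ (T : CovObj 𝒢), T.IsTempered → ∀ p : T.Point,
    ∃ i : ℕ, ∀ j, i ≤ j → (D.S j).Splits (T.component p))

/-- A level from which on the tower splits the component of `t ∈ T_{v₀}` (`T` tempered; cofinality).
[cite: MochizukiSemiAnbd2006, Prop 3.6 p.38] -/
noncomputable def levelOf (T : BTempCat 𝒢) (t : (T.obj.SV D.v₀).obj.V) : ℕ :=
  (hcof T.obj T.property (Sum.inl ⟨_, t⟩)).choose

/-- Specification of `levelOf`. [cite: MochizukiSemiAnbd2006, Prop 3.6 p.38] -/
theorem levelOf_spec (T : BTempCat 𝒢) (t : (T.obj.SV D.v₀).obj.V) (n : ℕ) (hn : D.levelOf hcof T t ≤ n) :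
    (D.S n).Splits (T.obj.component (Sum.inl ⟨_, t⟩)) :=
  (hcof T.obj T.property (Sum.inl ⟨_, t⟩)).choose_spec n hn

/-- **The fibre functor `B^temp(𝒢) ⥤ B^temp(π₁^temp(𝒢))`, `T ↦ T_{v₀}`, of the tower `D`.**
[cite: MochizukiSemiAnbd2006, Prop 3.6(ii) p.38] -/
noncomputable def fibreFunctor : BTempCat 𝒢 ⥤ BTemp (D.temperedPi h𝒢) where
  obj T := D.fibreObj h𝒢 T.obj (D.levelOf hcof T) (D.levelOf_spec hcof T)
  map {T T'} φ := D.fibreMap h𝒢 φ.hom (D.levelOf hcof T) (D.levelOf_spec hcof T)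
    (D.levelOf hcof T') (D.levelOf_spec hcof T')
  map_id T := by
    apply ObjectProperty.hom_ext
    apply Action.Hom.ext
    rfl
  map_comp φ ψ := by
    apply ObjectProperty.hom_ext
    apply Action.Hom.ext
    rfl

/-- The underlying set of `Φ_D(T)` is the fibre `T_{v₀}`. [cite: MochizukiSemiAnbd2006, Prop 3.6(ii) p.38] -/
theorem fibreFunctor_obj_V (T : BTempCat 𝒢) :
    ((D.fibreFunctor h𝒢 hcof).obj T).obj.V = (T.obj.SV D.v₀).obj.V := rfl

/-- The action on `Φ_D(T)` is `piAct`. [cite: MochizukiSemiAnbd2006, Prop 3.6(ii) p.38] -/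
theorem fibreFunctor_obj_ρ_apply (T : BTempCat 𝒢) (γ : D.temperedPi h𝒢) (t : (T.obj.SV D.v₀).obj.V) :
    ((D.fibreFunctor h𝒢 hcof).obj T).obj.ρ γ t =
      D.piAct h𝒢 T.obj (D.levelOf hcof T) (D.levelOf_spec hcof T) γ t := rfl

/-- The underlying map of `Φ_D(φ)` is `φ_{v₀}`. [cite: MochizukiSemiAnbd2006, Prop 3.6(ii) p.38] -/
theorem fibreFunctor_map_apply {T T' : BTempCat 𝒢} (φ : T ⟶ T') (t : (T.obj.SV D.v₀).obj.V) :
    ((D.fibreFunctor h𝒢 hcof).map φ).hom.hom t = (φ.hom.fV D.v₀).hom.hom t := rfl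

/-- **Faithfulness** (connectedness of `𝔾`). [cite: MochizukiSemiAnbd2006, Prop 3.6(ii) p.38] -/
theorem fibreFunctor_faithful (hc : 𝒢.graph.IsConnected) : (D.fibreFunctor h𝒢 hcof).Faithful where
  map_injective := by
    intro T T' φ ψ h
    have h1 : φ.hom.fV D.v₀ = ψ.hom.fV D.v₀ := by
      apply ObjectProperty.hom_ext
      apply Action.Hom.ext
      exact congrArg (fun m => m.hom.hom) h
    have h2 : φ.hom = ψ.hom := CovHom.ext_of_fV_eq φ.hom ψ.hom hc _ h1
    exact InducedCategory.hom_ext h2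

/-- **Fullness**: every `π₁^temp`-equivariant map of fibres comes from a morphism of coverings.
[cite: MochizukiSemiAnbd2006, Prop 3.6(ii) p.38] -/
theorem fibreFunctor_full (hc : 𝒢.graph.IsConnected) : (D.fibreFunctor h𝒢 hcof).Full where
  map_surjective {T T'} m := by
    refine ⟨ObjectProperty.homMk (D.fullHom h𝒢 hc T.obj T'.obj (D.levelOf hcof T)
      (D.levelOf_spec hcof T) (D.levelOf hcof T') (D.levelOf_spec hcof T') m), ?_⟩
    apply ObjectProperty.hom_ext
    apply Action.Hom.ext
    apply ConcreteCategory.hom_ext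
    intro t
    exact D.fullHom_base h𝒢 hc T.obj T'.obj _ _ _ _ m t

/-- **Essential surjectivity**: every object of `B^temp(π₁^temp)` is realised by a tempered covering (the
levels split themselves and are finite with nonempty fibres). [cite: MochizukiSemiAnbd2006, Prop 3.6(ii) p.38] -/
theorem fibreFunctor_essSurj (hS : ∀ n, (D.S n).Splits (D.S n)) (hfin : ∀ n, (D.S n).IsFinite)
    (hne : ∀ n, (D.S n).HasNonemptyFibres) : (D.fibreFunctor h𝒢 hcof).EssSurj where
  mem_essImage X := by
    let T : BTempCat 𝒢 := ⟨D.realize h𝒢 X, D.realize_isTempered h𝒢 X hS hfin hne⟩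
    exact ⟨T, ⟨D.fibreObjIsoOfLev h𝒢 (D.realize h𝒢 X) _ _ _ _ ≪≫ D.realizeIso h𝒢 X hS⟩⟩

/-- **The fibre functor is an equivalence.** [cite: MochizukiSemiAnbd2006, Prop 3.6(ii) p.38] -/
theorem fibreFunctor_isEquivalence (hc : 𝒢.graph.IsConnected) (hS : ∀ n, (D.S n).Splits (D.S n))
    (hfin : ∀ n, (D.S n).IsFinite) (hne : ∀ n, (D.S n).HasNonemptyFibres) :
    (D.fibreFunctor h𝒢 hcof).IsEquivalence where
  faithful := D.fibreFunctor_faithful h𝒢 hcof hc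
  full := D.fibreFunctor_full h𝒢 hcof hc
  essSurj := D.fibreFunctor_essSurj h𝒢 hcof hS hfin hne

/-- **`B^temp(𝒢) ≌ B^temp(lim_n Gal(𝒢_{∞,n}/𝒢))` for the tower `D`.** [cite: MochizukiSemiAnbd2006, Prop 3.6(ii) p.38] -/
noncomputable def chartEquiv (hc : 𝒢.graph.IsConnected) (hS : ∀ n, (D.S n).Splits (D.S n))
    (hfin : ∀ n, (D.S n).IsFinite) (hne : ∀ n, (D.S n).HasNonemptyFibres) :
    BTempCat 𝒢 ≌ BTemp (D.temperedPi h𝒢) :=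
  haveI := D.fibreFunctor_isEquivalence h𝒢 hcof hc hS hfin hne
  (D.fibreFunctor h𝒢 hcof).asEquivalence

/-- The functor of `chartEquiv` is the fibre functor (definitional). [cite: MochizukiSemiAnbd2006, Prop 3.6(ii) p.38] -/
theorem chartEquiv_functor (hc : 𝒢.graph.IsConnected) (hS : ∀ n, (D.S n).Splits (D.S n))
    (hfin : ∀ n, (D.S n).IsFinite) (hne : ∀ n, (D.S n).HasNonemptyFibres) :
    (D.chartEquiv h𝒢 hcof hc hS hfin hne).functor = D.fibreFunctor h𝒢 hcof := rfl

/-- **The tempered fundamental group chart of `𝒢` attached to the tower `D`** (Prop 3.6 (i)(ii) for ANY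
cofinal tower of Galois levels). [cite: MochizukiSemiAnbd2006, Prop 3.6(i)(ii) p.38] -/
noncomputable def chart (hc : 𝒢.graph.IsConnected) (hS : ∀ n, (D.S n).Splits (D.S n))
    (hfin : ∀ n, (D.S n).IsFinite) (hne : ∀ n, (D.S n).HasNonemptyFibres) : TemperedPiChart 𝒢 where
  G := D.temperedPi h𝒢
  isTempered := D.isTempered_temperedPi h𝒢
  secondCountableTopology := inferInstance
  equiv := D.chartEquiv h𝒢 hcof hc hS hfin hne

/-- The group of the chart of `D` is `D.temperedPi` (definitional). [cite: MochizukiSemiAnbd2006, Prop 3.6(i) p.38] -/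
theorem chart_G (hc : 𝒢.graph.IsConnected) (hS : ∀ n, (D.S n).Splits (D.S n))
    (hfin : ∀ n, (D.S n).IsFinite) (hne : ∀ n, (D.S n).HasNonemptyFibres) :
    (D.chart h𝒢 hcof hc hS hfin hne).G = D.temperedPi h𝒢 := rfl

/-- The chart's equivalence sends a tempered covering to its fibre over the base vertex with the
`piAct`-action (definitional). [cite: MochizukiSemiAnbd2006, Prop 3.6(ii) p.38] -/
theorem chart_equiv_functor_obj (hc : 𝒢.graph.IsConnected) (hS : ∀ n, (D.S n).Splits (D.S n))
    (hfin : ∀ n, (D.S n).IsFinite) (hne : ∀ n, (D.S n).HasNonemptyFibres) (T : BTempCat 𝒢) :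
    (D.chart h𝒢 hcof hc hS hfin hne).equiv.functor.obj T =
      D.fibreObj h𝒢 T.obj (D.levelOf hcof T) (D.levelOf_spec hcof T) := rfl

end GaloisLevelData

/-- The chart of `TemperedPiChartExists.lean` is the chart of the tower `𝒢.galoisLevelData h36` up to the
choice of splitting levels: both groups ARE `𝒢.temperedPi h36` (definitional).
[cite: MochizukiSemiAnbd2006, Prop 3.6(i) p.38] -/
theorem temperedPiChart_G_eq_chart_G (𝒢 : ProfiniteSemiGraph.{u}) (h36 : 𝒢.Prop36Hypotheses) :
    (𝒢.temperedPiChart h36).G =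
      ((𝒢.galoisLevelData h36).chart h36.isCountable (𝒢.exists_level_splits_component h36) h36.isConnected
        (𝒢.galoisLevelData_splits_self h36) (𝒢.galoisLevelData_isFinite h36)
        (𝒢.galoisLevelData_hasNonemptyFibres h36)).G := rfl

end ProfiniteSemiGraph

end Literature.AnabelianGeometry.SemiGraphs
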